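import Mathlib
import Summits.AnomalousDissipation.AnomalousDissipation.Theorems.DyadicWallCascadeDyadicRealisationLerayCappingTools
import Summits.AnomalousDissipation.AnomalousDissipation.Theorems.DyadicWallCascadeDyadicRealisationLerayCappingTools2
import Summits.AnomalousDissipation.AnomalousDissipation.Theorems.DyadicWallCascadeDyadicRealisationLerayCappingTools5
import HarnessLib

/-!
# Leray capping, tools VI: the solenoidal lid

Tools file for `stub_lerayCapping` of
`Summit.AnomalousDissipation.AnomalousDissipation.Theses.DyadicWallCascade.DyadicRealisation`
(line Sketch).  For a half-space hierarchy `(V, Q)` (smooth, bounded, divergence free, steady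
Euler, dilation invariant, band periodic, zero mass flux) the **lid**

  `U(Y) = θ(Y₂) V(Y) + θ(1 − Y₂) σV(AY) + c(Y)`,  `P(Y) = χ(Y₂) Q(Y) + χ(1 − Y₂) Q(AY)`

(`σ` the mirror, `A Y = σY + e₂`, `θ, χ` the vertical cut-offs of tools II, `c` the corrector of
tools V, `V, Q` extended by `0` below the wall) is smooth and divergence free on the layer
`0 < Y₂ < 1`, `1`-periodic in `Y₀, Y₁` on all of `ℝ³`, bounded on the closed unit cube, equal to
`(V, Q)` on `0 < Y₂ < 5/64` and to `(σV∘A, Q∘A)` on `59/64 < Y₂ < 1` (`lerayCapping_lid`).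

The file ends with the registered tools stub `stub_lerayCappingTools6`.
-/

open Set Function MeasureTheory Filter Topology
open scoped BigOperators ContDiff

set_option linter.dupNamespace false

namespace Summit.AnomalousDissipation.AnomalousDissipation.Theorems

/-- Divergence of a scalar multiple `a(Y₂) b(Y)` along the vertical profile `a`:
`div (a(Y₂) b)(Y) = a(Y₂) div b (Y) + a'(Y₂) b₂(Y)`. [folklore] -/
theorem lerayCapping_div_smul_profile (a : ℝ → ℝ)
    (b : EuclideanSpace ℝ (Fin 3) → EuclideanSpace ℝ (Fin 3)) (Y : EuclideanSpace ℝ (Fin 3))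
    (ha : DifferentiableAt ℝ a (Y 2)) (hb : DifferentiableAt ℝ b Y) :
    ∑ i : Fin 3, (fderiv ℝ (fun Z : EuclideanSpace ℝ (Fin 3) => a (Z 2) • b Z) Y
        (EuclideanSpace.single i (1 : ℝ))) i =
      a (Y 2) * ∑ i : Fin 3, (fderiv ℝ b Y (EuclideanSpace.single i (1 : ℝ))) i +
        deriv a (Y 2) * (b Y) 2 := by
  have hc : HasFDerivAt (fun Z : EuclideanSpace ℝ (Fin 3) => a (Z 2))
      (deriv a (Y 2) • PiLp.proj 2 (fun _ : Fin 3 => ℝ) 2) Y :=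
    ha.hasDerivAt.comp_hasFDerivAt Y (PiLp.hasFDerivAt_apply (𝕜 := ℝ) 2 Y 2)
  have h : HasFDerivAt (fun Z : EuclideanSpace ℝ (Fin 3) => a (Z 2) • b Z)
      (a (Y 2) • fderiv ℝ b Y + (deriv a (Y 2) • PiLp.proj 2 (fun _ : Fin 3 => ℝ) 2).smulRight (b Y))
      Y := hc.smul hb.hasFDerivAt
  rw [h.fderiv, Fin.sum_univ_three, Fin.sum_univ_three]
  simp
  ring

/-- **The solenoidal lid.** See the module docstring. [folklore] -/
theorem lerayCapping_lid
    (V : EuclideanSpace ℝ (Fin 3) → EuclideanSpace ℝ (Fin 3)) (Q : EuclideanSpace ℝ (Fin 3) → ℝ) (C : ℝ)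
    (hV : ContDiffOn ℝ ((⊤ : ℕ∞) : WithTop ℕ∞) V {X : EuclideanSpace ℝ (Fin 3) | 0 < X 2})
    (hQ : ContDiffOn ℝ ((⊤ : ℕ∞) : WithTop ℕ∞) Q {X : EuclideanSpace ℝ (Fin 3) | 0 < X 2})
    (hbd : ∀ X : EuclideanSpace ℝ (Fin 3), 0 < X 2 → ‖V X‖ ≤ C ∧ |Q X| ≤ C)
    (hdiv : ∀ X : EuclideanSpace ℝ (Fin 3), 0 < X 2 →
      ∑ i : Fin 3, (fderiv ℝ V X (EuclideanSpace.single i (1 : ℝ))) i = 0)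
    (hE : ∀ X : EuclideanSpace ℝ (Fin 3), 0 < X 2 → (fderiv ℝ V X) (V X) + gradient Q X = 0)
    (hdil : ∀ X : EuclideanSpace ℝ (Fin 3), 0 < X 2 → V ((2 : ℝ) • X) = V X ∧ Q ((2 : ℝ) • X) = Q X)
    (hper : ∀ X : EuclideanSpace ℝ (Fin 3), 1 ≤ X 2 → X 2 ≤ 2 →
      V (X + EuclideanSpace.single 0 (1 : ℝ)) = V X ∧ V (X + EuclideanSpace.single 1 (1 : ℝ)) = V X ∧
      Q (X + EuclideanSpace.single 0 (1 : ℝ)) = Q X ∧ Q (X + EuclideanSpace.single 1 (1 : ℝ)) = Q X)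
    (hmass : ∫ q in Icc (0 : ℝ) 1 ×ˢ Icc (0 : ℝ) 1, (V !₂[q.1, q.2, (1 : ℝ)]) 2 = 0) :
    ∃ (U : EuclideanSpace ℝ (Fin 3) → EuclideanSpace ℝ (Fin 3)) (P : EuclideanSpace ℝ (Fin 3) → ℝ),
      ContDiffOn ℝ ((⊤ : ℕ∞) : WithTop ℕ∞) U {Y : EuclideanSpace ℝ (Fin 3) | 0 < Y 2 ∧ Y 2 < 1} ∧
      ContDiffOn ℝ ((⊤ : ℕ∞) : WithTop ℕ∞) P {Y : EuclideanSpace ℝ (Fin 3) | 0 < Y 2 ∧ Y 2 < 1} ∧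
      (∀ Y : EuclideanSpace ℝ (Fin 3),
        U (Y + EuclideanSpace.single 0 (1 : ℝ)) = U Y ∧ U (Y + EuclideanSpace.single 1 (1 : ℝ)) = U Y ∧
        P (Y + EuclideanSpace.single 0 (1 : ℝ)) = P Y ∧ P (Y + EuclideanSpace.single 1 (1 : ℝ)) = P Y) ∧
      (∀ Y : EuclideanSpace ℝ (Fin 3), 0 < Y 2 → Y 2 < 1 →
        ∑ i : Fin 3, (fderiv ℝ U Y (EuclideanSpace.single i (1 : ℝ))) i = 0) ∧
      (∀ Y : EuclideanSpace ℝ (Fin 3), 0 < Y 2 → Y 2 < 5 / 64 → U Y = V Y ∧ P Y = Q Y) ∧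
      (∀ Y : EuclideanSpace ℝ (Fin 3), 59 / 64 < Y 2 → Y 2 < 1 →
        U Y = V (Y + (1 - 2 * Y 2) • EuclideanSpace.single 2 (1 : ℝ)) -
            (2 * (V (Y + (1 - 2 * Y 2) • EuclideanSpace.single 2 (1 : ℝ))) 2) •
              EuclideanSpace.single 2 (1 : ℝ) ∧
          P Y = Q (Y + (1 - 2 * Y 2) • EuclideanSpace.single 2 (1 : ℝ))) ∧
      (∃ M : ℝ, ∀ Y : EuclideanSpace ℝ (Fin 3), (∀ i, 0 ≤ Y i ∧ Y i ≤ 1) → ‖U Y‖ ≤ M) := by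
  set e0 : EuclideanSpace ℝ (Fin 3) := EuclideanSpace.single 0 (1 : ℝ) with he0
  set e1 : EuclideanSpace ℝ (Fin 3) := EuclideanSpace.single 1 (1 : ℝ) with he1
  set e2 : EuclideanSpace ℝ (Fin 3) := EuclideanSpace.single 2 (1 : ℝ) with he2
  set S : Set (EuclideanSpace ℝ (Fin 3)) := {Y | 0 < Y 2 ∧ Y 2 < 1} with hS
  have hc2c : Continuous fun Y : EuclideanSpace ℝ (Fin 3) => Y 2 := PiLp.continuous_apply 2 _ 2
  have hc2 : ContDiff ℝ ∞ fun Y : EuclideanSpace ℝ (Fin 3) => Y 2 := contDiff_piLp_apply (p := 2)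
  have hopen : IsOpen {X : EuclideanSpace ℝ (Fin 3) | 0 < X 2} := isOpen_lt continuous_const hc2c
  have hopen1 : IsOpen {X : EuclideanSpace ℝ (Fin 3) | X 2 < 1} := isOpen_lt hc2c continuous_const
  have hSo : IsOpen S := hopen.inter hopen1
  -- profiles, corrector, reflection, mirrored pair
  obtain ⟨θ, χ, hθs, hχs, hθ01, hχ01, hθ1, hθ0, hθ', hχ1, hχ0, -⟩ := lerayCapping_profiles
  obtain ⟨c, hcs, hcp0, hcp1, hcz2, hcdiv, hcsupp⟩ :=
    lerayCapping_lid_corrector V Q θ hV hdiv hdil hper hmass hθs hθ'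
  obtain ⟨Smap, hSY, hSS, hSnorm, -, hSco, -⟩ := lerayCapping_reflection
  obtain ⟨hTs, hqs, hTdiv, -⟩ := lerayCapping_mirror_euler V Q hV hQ hdiv hE
  have hperw : ∀ X : EuclideanSpace ℝ (Fin 3), 0 < X 2 → X 2 ≤ 2 →
      V (X + e0) = V X ∧ V (X + e1) = V X ∧ Q (X + e0) = Q X ∧ Q (X + e1) = Q X :=
    fun X h1 h2 => lerayCapping_periodic_near_wall V Q hdil hper X h1 h2
  -- extensions by zero
  set Vp : EuclideanSpace ℝ (Fin 3) → EuclideanSpace ℝ (Fin 3) := fun Y => if 0 < Y 2 then V Y else 0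
    with hVp
  set Qp : EuclideanSpace ℝ (Fin 3) → ℝ := fun Y => if 0 < Y 2 then Q Y else 0 with hQp
  have hVp_pos : ∀ Y : EuclideanSpace ℝ (Fin 3), 0 < Y 2 → Vp Y = V Y := fun Y hY => by
    simp only [hVp, if_pos hY]
  have hVp_np : ∀ Y : EuclideanSpace ℝ (Fin 3), ¬ 0 < Y 2 → Vp Y = 0 := fun Y hY => by
    simp only [hVp, if_neg hY]
  have hQp_pos : ∀ Y : EuclideanSpace ℝ (Fin 3), 0 < Y 2 → Qp Y = Q Y := fun Y hY => by
    simp only [hQp, if_pos hY]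
  have hQp_np : ∀ Y : EuclideanSpace ℝ (Fin 3), ¬ 0 < Y 2 → Qp Y = 0 := fun Y hY => by
    simp only [hQp, if_neg hY]
  have hVp_bd : ∀ Y, ‖Vp Y‖ ≤ max C 0 := fun Y => by
    by_cases h : 0 < Y 2
    · rw [hVp_pos Y h]; exact (hbd Y h).1.trans (le_max_left _ _)
    · rw [hVp_np Y h, norm_zero]; exact le_max_right _ _
  have hVpS : ContDiffOn ℝ ∞ Vp {X : EuclideanSpace ℝ (Fin 3) | 0 < X 2} := hV.congr fun Y hY => hVp_pos Y hY
  have hQpS : ContDiffOn ℝ ∞ Qp {X : EuclideanSpace ℝ (Fin 3) | 0 < X 2} := hQ.congr fun Y hY => hQp_pos Y hY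
  have hper_ext : ∀ (j : Fin 3), (j = 0 ∨ j = 1) → ∀ Y : EuclideanSpace ℝ (Fin 3), Y 2 ≤ 2 →
      Vp (Y + EuclideanSpace.single j (1 : ℝ)) = Vp Y ∧ Qp (Y + EuclideanSpace.single j (1 : ℝ)) = Qp Y := by
    intro j hj Y hY2
    have hYj : (Y + EuclideanSpace.single j (1 : ℝ)) 2 = Y 2 := by
      rcases hj with rfl | rfl <;> simp
    by_cases h : 0 < Y 2
    · rw [hVp_pos _ (by rw [hYj]; exact h), hVp_pos _ h, hQp_pos _ (by rw [hYj]; exact h), hQp_pos _ h]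
      rcases hj with rfl | rfl
      · exact ⟨(hperw Y h hY2).1, (hperw Y h hY2).2.2.1⟩
      · exact ⟨(hperw Y h hY2).2.1, (hperw Y h hY2).2.2.2⟩
    · rw [hVp_np _ (by rw [hYj]; exact h), hVp_np _ h, hQp_np _ (by rw [hYj]; exact h), hQp_np _ h]
      exact ⟨rfl, rfl⟩
  -- the affine reflection and the mirrored pieces
  set A : EuclideanSpace ℝ (Fin 3) → EuclideanSpace ℝ (Fin 3) := fun Y => Y + (1 - 2 * Y 2) • e2 with hA
  have hA2 : ∀ Y, (A Y) 2 = 1 - Y 2 := fun Y => by simp [hA, he2]; ring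
  have hAs : ContDiff ℝ ∞ A := contDiff_id.add ((contDiff_const.sub (contDiff_const.mul hc2)).smul contDiff_const)
  have hAj : ∀ (j : Fin 3), (j = 0 ∨ j = 1) → ∀ Y : EuclideanSpace ℝ (Fin 3),
      A (Y + EuclideanSpace.single j (1 : ℝ)) = A Y + EuclideanSpace.single j (1 : ℝ) := by
    intro j hj Y
    have hYj : (Y + EuclideanSpace.single j (1 : ℝ)) 2 = Y 2 := by
      rcases hj with rfl | rfl <;> simp
    simp only [hA, hYj]
    abel
  set Tp : EuclideanSpace ℝ (Fin 3) → EuclideanSpace ℝ (Fin 3) :=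
    fun Y => Vp (A Y) - (2 * (Vp (A Y)) 2) • e2 with hTp
  have hTpT : ∀ Y : EuclideanSpace ℝ (Fin 3), Y 2 < 1 →
      Tp Y = V (A Y) - (2 * (V (A Y)) 2) • e2 := fun Y hY => by
    simp only [hTp, hVp_pos (A Y) (by rw [hA2]; linarith)]
  have hTpS : ∀ Y, Tp Y = Smap (Vp (A Y)) := fun Y => by rw [hSY]
  have hTp2 : ∀ Y, (Tp Y) 2 = -(Vp (A Y)) 2 := fun Y => by rw [hTpS]; exact (hSco _).2.2
  have hTp_bd : ∀ Y, ‖Tp Y‖ ≤ max C 0 := fun Y => by rw [hTpS, hSnorm]; exact hVp_bd _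
  have hTp_on : ContDiffOn ℝ ∞ Tp {Y : EuclideanSpace ℝ (Fin 3) | Y 2 < 1} :=
    hTs.congr fun Y hY => hTpT Y hY
  have hQA_on : ContDiffOn ℝ ∞ (fun Y => Qp (A Y)) {Y : EuclideanSpace ℝ (Fin 3) | Y 2 < 1} :=
    hqs.congr fun Y hY => by
      simp only [mem_setOf_eq] at hY
      exact hQp_pos (A Y) (by rw [hA2]; linarith)
  -- the lid and the pressure
  set U : EuclideanSpace ℝ (Fin 3) → EuclideanSpace ℝ (Fin 3) :=
    fun Y => θ (Y 2) • Vp Y + θ (1 - Y 2) • Tp Y + c Y with hU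
  set P : EuclideanSpace ℝ (Fin 3) → ℝ := fun Y => χ (Y 2) * Qp Y + χ (1 - Y 2) * Qp (A Y) with hP
  have hθc : ContDiff ℝ ∞ fun Y : EuclideanSpace ℝ (Fin 3) => θ (Y 2) := hθs.comp hc2
  have hθc' : ContDiff ℝ ∞ fun Y : EuclideanSpace ℝ (Fin 3) => θ (1 - Y 2) :=
    hθs.comp (contDiff_const.sub hc2)
  have hχc : ContDiff ℝ ∞ fun Y : EuclideanSpace ℝ (Fin 3) => χ (Y 2) := hχs.comp hc2
  have hχc' : ContDiff ℝ ∞ fun Y : EuclideanSpace ℝ (Fin 3) => χ (1 - Y 2) :=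
    hχs.comp (contDiff_const.sub hc2)
  have hU_on : ContDiffOn ℝ ∞ U S :=
    ((hθc.contDiffOn.smul (hVpS.mono fun Y hY => hY.1)).add
      (hθc'.contDiffOn.smul (hTp_on.mono fun Y hY => hY.2))).add hcs.contDiffOn
  have hP_on : ContDiffOn ℝ ∞ P S :=
    (hχc.contDiffOn.mul (hQpS.mono fun Y hY => hY.1)).add
      (hχc'.contDiffOn.mul (hQA_on.mono fun Y hY => hY.2))
  refine ⟨U, P, hU_on, hP_on, fun Y => ?_, fun Y hY0 hY1 => ?_, fun Y hY0 hY1 => ?_,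
    fun Y hY0 hY1 => ?_, ?_⟩
  · -- periodicity
    have key : ∀ (j : Fin 3), (j = 0 ∨ j = 1) →
        U (Y + EuclideanSpace.single j (1 : ℝ)) = U Y ∧ P (Y + EuclideanSpace.single j (1 : ℝ)) = P Y := by
      intro j hj
      have hYj : (Y + EuclideanSpace.single j (1 : ℝ)) 2 = Y 2 := by
        rcases hj with rfl | rfl <;> simp
      have hcj : c (Y + EuclideanSpace.single j (1 : ℝ)) = c Y := by
        rcases hj with rfl | rfl
        · exact hcp0 Y
        · exact hcp1 Y
      -- the lower pieces
      have h1 : θ (Y 2) • Vp (Y + EuclideanSpace.single j (1 : ℝ)) = θ (Y 2) • Vp Y ∧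
          χ (Y 2) * Qp (Y + EuclideanSpace.single j (1 : ℝ)) = χ (Y 2) * Qp Y := by
        by_cases hY : Y 2 ≤ 2
        · rw [(hper_ext j hj Y hY).1, (hper_ext j hj Y hY).2]; exact ⟨rfl, rfl⟩
        · have hY' : 2 < Y 2 := not_le.1 hY
          rw [hθ0 _ (by linarith), hχ0 _ (by linarith)]; simp
      -- the upper pieces
      have h2 : θ (1 - Y 2) • Tp (Y + EuclideanSpace.single j (1 : ℝ)) = θ (1 - Y 2) • Tp Y ∧
          χ (1 - Y 2) * Qp (A (Y + EuclideanSpace.single j (1 : ℝ))) = χ (1 - Y 2) * Qp (A Y) := by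
        simp only [hTp, hAj j hj Y]
        by_cases hY : (A Y) 2 ≤ 2
        · rw [(hper_ext j hj (A Y) hY).1, (hper_ext j hj (A Y) hY).2]; exact ⟨rfl, rfl⟩
        · have hY' : 2 < 1 - Y 2 := by rw [← hA2]; exact not_le.1 hY
          rw [hθ0 _ (by linarith), hχ0 _ (by linarith)]; simp
      simp only [hU, hP, hYj, h1.1, h1.2, h2.1, h2.2, hcj, and_self]
    exact ⟨(key 0 (Or.inl rfl)).1, (key 1 (Or.inr rfl)).1, (key 0 (Or.inl rfl)).2, (key 1 (Or.inr rfl)).2⟩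
  · -- divergence on the layer
    have hYS : Y ∈ S := ⟨hY0, hY1⟩
    have hθd : ∀ t, DifferentiableAt ℝ θ t := fun t => (hθs.differentiable (by simp)) t
    have hVpd : DifferentiableAt ℝ Vp Y :=
      (hVpS.differentiableOn (by simp)).differentiableAt (hopen.mem_nhds hY0)
    have hTpd : DifferentiableAt ℝ Tp Y :=
      (hTp_on.differentiableOn (by simp)).differentiableAt (hopen1.mem_nhds hY1)
    have hcd : DifferentiableAt ℝ c Y := (hcs.differentiable (by simp)) Y
    have hd1 : DifferentiableAt ℝ (fun Z : EuclideanSpace ℝ (Fin 3) => θ (Z 2) • Vp Z) Y :=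
      ((hθd _).comp Y (hc2.differentiable (by simp) Y)).smul hVpd
    have hd2 : DifferentiableAt ℝ (fun Z : EuclideanSpace ℝ (Fin 3) => θ (1 - Z 2) • Tp Z) Y :=
      ((hθd _).comp Y ((hc2.differentiable (by simp) Y).const_sub 1)).smul hTpd
    have hsplit : ∀ i : Fin 3, (fderiv ℝ U Y (EuclideanSpace.single i (1 : ℝ))) i =
        (fderiv ℝ (fun Z : EuclideanSpace ℝ (Fin 3) => θ (Z 2) • Vp Z) Y (EuclideanSpace.single i (1 : ℝ))) i +
        (fderiv ℝ (fun Z : EuclideanSpace ℝ (Fin 3) => θ (1 - Z 2) • Tp Z) Y (EuclideanSpace.single i (1 : ℝ))) i +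
        (fderiv ℝ c Y (EuclideanSpace.single i (1 : ℝ))) i := by
      intro i
      have : U = fun Z => θ (Z 2) • Vp Z + θ (1 - Z 2) • Tp Z + c Z := rfl
      rw [this, fderiv_fun_add (hd1.fun_add hd2) hcd, fderiv_fun_add hd1 hd2]
      simp only [_root_.add_apply, PiLp.add_apply]
    simp_rw [hsplit, Finset.sum_add_distrib]
    -- first piece
    have hdivVp : ∑ i : Fin 3, (fderiv ℝ Vp Y (EuclideanSpace.single i (1 : ℝ))) i = 0 := by
      have hev : Vp =ᶠ[𝓝 Y] V := Filter.eventuallyEq_of_mem (hopen.mem_nhds hY0) fun Z hZ => hVp_pos Z hZ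
      rw [hev.fderiv_eq]; exact hdiv Y hY0
    have hdivTp : ∑ i : Fin 3, (fderiv ℝ Tp Y (EuclideanSpace.single i (1 : ℝ))) i = 0 := by
      have hev : Tp =ᶠ[𝓝 Y] fun Y => V (A Y) - (2 * (V (A Y)) 2) • e2 :=
        Filter.eventuallyEq_of_mem (hopen1.mem_nhds hY1) fun Z hZ => hTpT Z hZ
      rw [hev.fderiv_eq]; exact hTdiv Y hY1
    have hp1 := lerayCapping_div_smul_profile θ Vp Y (hθd _) hVpd
    have hp2 := lerayCapping_div_smul_profile (fun t => θ (1 - t)) Tp Y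
      ((hθd _).comp (Y 2) ((differentiableAt_id).const_sub 1)) hTpd
    have hderiv2 : deriv (fun t => θ (1 - t)) (Y 2) = -deriv θ (1 - Y 2) := by
      rw [deriv_comp_const_sub]
    simp only at hp2
    rw [hp1, hp2, hdivVp, hdivTp, hderiv2, hcdiv Y hY0 hY1, hTp2, hVp_pos Y hY0,
      hVp_pos (A Y) (by rw [hA2]; linarith)]
    ring
  · -- the lower collar
    have h1 : θ (Y 2) = 1 := hθ1 _ hY1.le
    have h2 : θ (1 - Y 2) = 0 := hθ0 _ (by linarith)
    have h3 : χ (Y 2) = 1 := hχ1 _ (by linarith)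
    have h4 : χ (1 - Y 2) = 0 := hχ0 _ (by linarith)
    have h5 : c Y = 0 := hcsupp Y (Or.inl hY1.le)
    simp only [hU, hP, h1, h2, h3, h4, h5, one_smul, zero_smul, add_zero, one_mul, zero_mul,
      hVp_pos Y hY0, hQp_pos Y hY0, and_self]
  · -- the upper collar
    have h1 : θ (Y 2) = 0 := hθ0 _ (by linarith)
    have h2 : θ (1 - Y 2) = 1 := hθ1 _ (by linarith)
    have h3 : χ (Y 2) = 0 := hχ0 _ (by linarith)
    have h4 : χ (1 - Y 2) = 1 := hχ1 _ (by linarith)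
    have h5 : c Y = 0 := hcsupp Y (Or.inr (Or.inr hY0.le))
    simp only [hU, hP, h1, h2, h3, h4, h5, one_smul, zero_smul, zero_add, add_zero, one_mul,
      zero_mul, hTpT Y hY1, hQp_pos (A Y) (by rw [hA2]; linarith)]
    exact ⟨rfl, rfl⟩
  · -- boundedness on the closed unit cube
    set K : Set (EuclideanSpace ℝ (Fin 3)) := {Y | ∀ i, 0 ≤ Y i ∧ Y i ≤ 1} with hK
    have hKc : IsCompact K := by
      have : K = (WithLp.toLp 2) '' (Set.pi univ fun _ : Fin 3 => Icc (0 : ℝ) 1) := by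
        ext Y
        simp only [hK, mem_setOf_eq, mem_image, mem_univ_pi, mem_Icc]
        constructor
        · intro h; exact ⟨WithLp.ofLp Y, h, rfl⟩
        · rintro ⟨x, hx, rfl⟩; exact hx
      rw [this]
      exact (isCompact_univ_pi fun _ => isCompact_Icc).image (PiLp.continuous_toLp 2 _)
    obtain ⟨M, hM⟩ := hKc.exists_bound_of_continuousOn hcs.continuous.continuousOn
    refine ⟨max C 0 + max C 0 + M, fun Y hY => ?_⟩
    have hθb : ∀ t, |θ t| ≤ 1 := fun t => abs_le.2 ⟨by linarith [(hθ01 t).1], (hθ01 t).2⟩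
    calc ‖U Y‖ ≤ ‖θ (Y 2) • Vp Y‖ + ‖θ (1 - Y 2) • Tp Y‖ + ‖c Y‖ := norm_add₃_le
      _ ≤ max C 0 + max C 0 + M := by
        gcongr
        · rw [norm_smul, Real.norm_eq_abs]
          calc |θ (Y 2)| * ‖Vp Y‖ ≤ 1 * max C 0 :=
                mul_le_mul (hθb _) (hVp_bd Y) (norm_nonneg _) zero_le_one
            _ = max C 0 := one_mul _
        · rw [norm_smul, Real.norm_eq_abs]
          calc |θ (1 - Y 2)| * ‖Tp Y‖ ≤ 1 * max C 0 :=
                mul_le_mul (hθb _) (hTp_bd Y) (norm_nonneg _) zero_le_one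
            _ = max C 0 := one_mul _
        · exact hM Y hY

/-- Registered tools stub of `stub_lerayCapping` (line Sketch of crux `DyadicRealisation`): the
conjunction of the lemmas of this file. [folklore] -/
theorem stub_lerayCappingTools6 :
    (∀ (a : ℝ → ℝ) (b : EuclideanSpace ℝ (Fin 3) → EuclideanSpace ℝ (Fin 3)) (Y : EuclideanSpace ℝ (Fin 3)), DifferentiableAt ℝ a (Y 2) → DifferentiableAt ℝ b Y →
      ∑ i : Fin 3, (fderiv ℝ (fun Z : EuclideanSpace ℝ (Fin 3) => a (Z 2) • b Z) Y (EuclideanSpace.single i (1 : ℝ))) i =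
        a (Y 2) * ∑ i : Fin 3, (fderiv ℝ b Y (EuclideanSpace.single i (1 : ℝ))) i +
          deriv a (Y 2) * (b Y) 2) ∧
    (∀ (V : EuclideanSpace ℝ (Fin 3) → EuclideanSpace ℝ (Fin 3)) (Q : EuclideanSpace ℝ (Fin 3) → ℝ) (C : ℝ),
      ContDiffOn ℝ ((⊤ : ℕ∞) : WithTop ℕ∞) V {X : EuclideanSpace ℝ (Fin 3) | 0 < X 2} →
      ContDiffOn ℝ ((⊤ : ℕ∞) : WithTop ℕ∞) Q {X : EuclideanSpace ℝ (Fin 3) | 0 < X 2} →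
      (∀ X : EuclideanSpace ℝ (Fin 3), 0 < X 2 → ‖V X‖ ≤ C ∧ |Q X| ≤ C) →
      (∀ X : EuclideanSpace ℝ (Fin 3), 0 < X 2 → ∑ i : Fin 3, (fderiv ℝ V X (EuclideanSpace.single i (1 : ℝ))) i = 0) →
      (∀ X : EuclideanSpace ℝ (Fin 3), 0 < X 2 → (fderiv ℝ V X) (V X) + gradient Q X = 0) →
      (∀ X : EuclideanSpace ℝ (Fin 3), 0 < X 2 → V ((2 : ℝ) • X) = V X ∧ Q ((2 : ℝ) • X) = Q X) →
      (∀ X : EuclideanSpace ℝ (Fin 3), 1 ≤ X 2 → X 2 ≤ 2 →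
        V (X + EuclideanSpace.single 0 (1 : ℝ)) = V X ∧ V (X + EuclideanSpace.single 1 (1 : ℝ)) = V X ∧
        Q (X + EuclideanSpace.single 0 (1 : ℝ)) = Q X ∧ Q (X + EuclideanSpace.single 1 (1 : ℝ)) = Q X) →
      (∫ q in Set.Icc (0 : ℝ) 1 ×ˢ Set.Icc (0 : ℝ) 1, (V !₂[q.1, q.2, (1 : ℝ)]) 2 = 0) →
      ∃ (U : EuclideanSpace ℝ (Fin 3) → EuclideanSpace ℝ (Fin 3)) (P : EuclideanSpace ℝ (Fin 3) → ℝ),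
        ContDiffOn ℝ ((⊤ : ℕ∞) : WithTop ℕ∞) U {Y : EuclideanSpace ℝ (Fin 3) | 0 < Y 2 ∧ Y 2 < 1} ∧
        ContDiffOn ℝ ((⊤ : ℕ∞) : WithTop ℕ∞) P {Y : EuclideanSpace ℝ (Fin 3) | 0 < Y 2 ∧ Y 2 < 1} ∧
        (∀ Y : EuclideanSpace ℝ (Fin 3),
          U (Y + EuclideanSpace.single 0 (1 : ℝ)) = U Y ∧ U (Y + EuclideanSpace.single 1 (1 : ℝ)) = U Y ∧
          P (Y + EuclideanSpace.single 0 (1 : ℝ)) = P Y ∧ P (Y + EuclideanSpace.single 1 (1 : ℝ)) = P Y) ∧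
        (∀ Y : EuclideanSpace ℝ (Fin 3), 0 < Y 2 → Y 2 < 1 →
          ∑ i : Fin 3, (fderiv ℝ U Y (EuclideanSpace.single i (1 : ℝ))) i = 0) ∧
        (∀ Y : EuclideanSpace ℝ (Fin 3), 0 < Y 2 → Y 2 < 5 / 64 → U Y = V Y ∧ P Y = Q Y) ∧
        (∀ Y : EuclideanSpace ℝ (Fin 3), 59 / 64 < Y 2 → Y 2 < 1 →
          U Y = V (Y + (1 - 2 * Y 2) • EuclideanSpace.single 2 (1 : ℝ)) -
              (2 * (V (Y + (1 - 2 * Y 2) • EuclideanSpace.single 2 (1 : ℝ))) 2) •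
                EuclideanSpace.single 2 (1 : ℝ) ∧
            P Y = Q (Y + (1 - 2 * Y 2) • EuclideanSpace.single 2 (1 : ℝ))) ∧
        (∃ M : ℝ, ∀ Y : EuclideanSpace ℝ (Fin 3), (∀ i, 0 ≤ Y i ∧ Y i ≤ 1) → ‖U Y‖ ≤ M)) :=
  ⟨lerayCapping_div_smul_profile, lerayCapping_lid⟩

end Summit.AnomalousDissipation.AnomalousDissipation.Theorems
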